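import Literature.Analysis.FluidPDE.SereginZajaczkowski2007SwirlRotation
import HarnessLib

/-!
# Seregin–Zajaczkowski 2007, (4.15): the pressure drops out of the swirl equation

G. Seregin, W. Zajaczkowski, *A sufficient condition of regularity for axially symmetric
solutions to the Navier–Stokes equations*, SIAM J. Math. Anal. 39 (2007) 669–685 =
arXiv:math/0702720, §4, proof of Lemma 4.3: "We know that `V_φ` satisfies the equation (4.15)"
— the swirl equation, which contains no pressure term because "`v_ϱ, v_φ, v₃` and `p` are
independent of the polar angle" (§1), i.e. `(∇P)_φ = 0`.

Support file (everything proved; no named facts) for the discharge of the named fact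
`SereginZajaczkowski2007.SwirlEquation` (`SereginZajaczkowski2007SwirlEquation.lean`). For the
hypothesis class of Prop. 4.1 the pressure is only `L^{3/2}_loc` and its symmetry is NOT
recorded; this file proves what the swirl equation needs from it, directly from the distributional
Navier–Stokes system and the axial symmetry of the velocity:

> for a distributional solution `(V, P)` (`f = 0`) on a rotation-invariant open set
> `Q ⊆ ℝ × ℝ³` whose velocity is equivariant under the rotations about the axis at the points of
> `Q`, and every scalar test function `φ ∈ C_c^∞(Q)`,
> `∫∫_Q P ⟪J x, ∇ₓφ⟫ dx dt = 0`, `J x = (-x₁, x₀, 0) = ϱ e_φ`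
> (`setIntegral_pressure_mul_inner_rotGen_gradient_eq_zero`).

Proof. Test the momentum equation with a field `ψ` and with its conjugates
`ψ_θ(t, x) = R_θ⁻¹ ψ(t, R_θ x)` (sibling file `SereginZajaczkowski2007SwirlRotation.lean`:
covariance of each velocity term, `div ψ_θ = (div ψ)(·, R_θ ·)`); after the measure-preserving
change of variables `(t, x) ↦ (t, R_θ x)` the function `θ ↦ ∫∫_Q P(t, x) (div ψ)(t, R_θ x)` is
constant (`setIntegral_pressure_mul_divergence_stRot`; this needs the integrability on `Q` of the
terms of the weak formulation, `integrableOn_nsVPart`, `integrableOn_pressure_mul_divergence`).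
For `ψ = φ J`, `div ψ = ⟪J, ∇φ⟫` and `⟪J(R_θ x), ∇φ(t, R_θ x)⟫ = (d/dθ) φ(t, R_θ x)`, whose
integral over `θ ∈ [0, 2π]` vanishes; averaging the constant function over `[0, 2π]` (Fubini)
gives the claim. No regularity of `P` beyond `L¹_loc(Q)` is used.

## References

* G. Seregin, W. Zajaczkowski, SIAM J. Math. Anal. 39 (2007) 669–685, arXiv:math/0702720, §1
  (standing symmetry convention "`p` independent of the polar angle"), §4 proof of Lemma 4.3,
  (4.15). [`SereginZajaczkowski2007`]
* A. J. Majda, A. L. Bertozzi, *Vorticity and Incompressible Flow* (CUP 2002), §1.2,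
  Prop. 1.1 (iii) (rotation symmetry of the equations).
-/

noncomputable section

open MeasureTheory Set Function Filter Topology TopologicalSpace Metric WithLp
open scoped NNReal ENNReal ContDiff InnerProductSpace RealInnerProductSpace Laplacian

namespace Literature.Analysis.FluidPDE

namespace SereginZajaczkowski2007

open SereginSverak2009

/-! ### Integrability of the terms of the weak formulation -/

section Integrability

variable {Q : Opens (ℝ × (EuclideanSpace ℝ (Fin 3)))} {ν : ℝ} {f V : ℝ → (EuclideanSpace ℝ (Fin 3)) → (EuclideanSpace ℝ (Fin 3))} {P : ℝ → (EuclideanSpace ℝ (Fin 3)) → ℝ}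

/-- A function dominated by a multiple of a locally integrable weight and vanishing off a compact
subset of the open set is integrable on it. [folklore] -/
theorem integrableOn_of_norm_le_of_eq_zero {w F : ℝ × (EuclideanSpace ℝ (Fin 3)) → ℝ}
    (hw : LocallyIntegrableOn w (Q : Set (ℝ × (EuclideanSpace ℝ (Fin 3)))) volume)
    (hF : AEStronglyMeasurable F (volume.restrict (Q : Set (ℝ × (EuclideanSpace ℝ (Fin 3))))))
    {K : Set (ℝ × (EuclideanSpace ℝ (Fin 3)))} (hK : IsCompact K) (hKQ : K ⊆ (Q : Set (ℝ × (EuclideanSpace ℝ (Fin 3))))) {M : ℝ}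
    (hM : ∀ z, ‖F z‖ ≤ M * ‖w z‖) (h0 : ∀ z, z ∉ K → F z = 0) :
    IntegrableOn F (Q : Set (ℝ × (EuclideanSpace ℝ (Fin 3)))) volume := by
  have hwK : IntegrableOn w K volume := hw.integrableOn_compact_subset hKQ hK
  have hFK : IntegrableOn F K volume :=
    Integrable.mono' (hwK.norm.const_mul M) (hF.mono_set hKQ) (Eventually.of_forall hM)
  exact hFK.of_forall_sdiff_eq_zero Q.isOpen.measurableSet fun z hz => h0 z hz.2

/-- Outside the support of a space–time test field its slice derivatives vanish. [folklore] -/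
theorem fderiv_slice_eq_zero_of_notMem {F : Type*} [NormedAddCommGroup F] [NormedSpace ℝ F]
    {ψ : ℝ → (EuclideanSpace ℝ (Fin 3)) → F} {t : ℝ} {x : (EuclideanSpace ℝ (Fin 3))} (h : (t, x) ∉ tsupport (uncurry ψ)) :
    fderiv ℝ (ψ t) x = 0 := by
  have h0 : uncurry ψ =ᶠ[𝓝 (t, x)] 0 := notMem_tsupport_iff_eventuallyEq.1 h
  have hc : Continuous fun y : (EuclideanSpace ℝ (Fin 3)) => (t, y) := continuous_const.prodMk continuous_id
  have h1 : ψ t =ᶠ[𝓝 x] fun _ => (0 : F) := (hc.tendsto x).eventually h0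
  rw [h1.fderiv_eq, fderiv_fun_const, Pi.zero_apply]

/-- Outside the support of a space–time test field the slice Laplacian vanishes. [folklore] -/
theorem laplacian_slice_eq_zero_of_notMem {F : Type*} [NormedAddCommGroup F] [NormedSpace ℝ F]
    {ψ : ℝ → (EuclideanSpace ℝ (Fin 3)) → F} {t : ℝ} {x : (EuclideanSpace ℝ (Fin 3))} (h : (t, x) ∉ tsupport (uncurry ψ)) : Δ (ψ t) x = 0 := by
  have h0 : uncurry ψ =ᶠ[𝓝 (t, x)] 0 := notMem_tsupport_iff_eventuallyEq.1 h
  have hc : Continuous fun y : (EuclideanSpace ℝ (Fin 3)) => (t, y) := continuous_const.prodMk continuous_id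
  have h1 : ψ t =ᶠ[𝓝 x] fun _ => (0 : F) := (hc.tendsto x).eventually h0
  rw [(InnerProductSpace.laplacian_congr_nhds h1).self_of_nhds, InnerProductSpace.laplacian_const,
    Pi.zero_apply]

/-- A continuous compactly supported function is bounded. [folklore] -/
theorem exists_norm_le_of_hasCompactSupport {X G : Type*} [TopologicalSpace X]
    [NormedAddCommGroup G] {g : X → G} (hg : Continuous g) (hc : HasCompactSupport g) :
    ∃ C, 0 ≤ C ∧ ∀ x, ‖g x‖ ≤ C := by
  obtain ⟨C, hC⟩ := hg.bounded_above_of_compact_support hc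
  exact ⟨max C 0, le_max_right _ _, fun x => (hC x).trans (le_max_left _ _)⟩

/-- **The velocity part is integrable on `Q`** for a distributional solution and a test field on
`Q` (`V ∈ L¹_loc(Q)`, `|V|² ∈ L¹_loc(Q)`, the derivatives of `ψ` are bounded and supported in a
compact subset of `Q`). [folklore] -/
theorem integrableOn_nsVPart (hNS : IsDistributionalNSSolutionOn Q ν f V P) {ψ : ℝ → (EuclideanSpace ℝ (Fin 3)) → (EuclideanSpace ℝ (Fin 3))}
    (hψ : IsSpaceTimeTestOn Q ψ) : IntegrableOn (nsVPart ν V ψ) (Q : Set (ℝ × (EuclideanSpace ℝ (Fin 3)))) volume := by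
  have hK : IsCompact (tsupport (uncurry ψ)) := hψ.hasCompactSupport
  have hKQ : tsupport (uncurry ψ) ⊆ (Q : Set (ℝ × (EuclideanSpace ℝ (Fin 3)))) := hψ.tsupport_subset
  have hV1 : LocallyIntegrableOn (fun z : ℝ × (EuclideanSpace ℝ (Fin 3)) => ‖V z.1 z.2‖) (Q : Set (ℝ × (EuclideanSpace ℝ (Fin 3)))) volume :=
    hNS.1.norm
  have hV2 : LocallyIntegrableOn (fun z : ℝ × (EuclideanSpace ℝ (Fin 3)) => ‖V z.1 z.2‖ ^ 2) (Q : Set (ℝ × (EuclideanSpace ℝ (Fin 3)))) volume :=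
    hNS.2.1
  have hVm : AEStronglyMeasurable (fun z : ℝ × (EuclideanSpace ℝ (Fin 3)) => V z.1 z.2)
      (volume.restrict (Q : Set (ℝ × (EuclideanSpace ℝ (Fin 3))))) := hNS.1.aestronglyMeasurable
  -- bounds for the derivatives of `ψ`
  have hTc : Continuous fun z : ℝ × (EuclideanSpace ℝ (Fin 3)) => timeDeriv ψ z.1 z.2 := hψ.continuous_timeDeriv
  have hTs : HasCompactSupport fun z : ℝ × (EuclideanSpace ℝ (Fin 3)) => timeDeriv ψ z.1 z.2 :=
    HasCompactSupport.intro hK fun z hz => timeDeriv_eq_zero_off_tsupport hz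
  obtain ⟨C₁, -, hC₁⟩ := exists_norm_le_of_hasCompactSupport hTc hTs
  have hDc : Continuous fun z : ℝ × (EuclideanSpace ℝ (Fin 3)) => fderiv ℝ (ψ z.1) z.2 := hψ.continuous_fderiv_slice
  have hDs : HasCompactSupport fun z : ℝ × (EuclideanSpace ℝ (Fin 3)) => fderiv ℝ (ψ z.1) z.2 :=
    HasCompactSupport.intro hK fun z hz => fderiv_slice_eq_zero_of_notMem hz
  obtain ⟨C₂, hC₂, hC₂'⟩ := exists_norm_le_of_hasCompactSupport hDc hDs
  have hLc : Continuous fun z : ℝ × (EuclideanSpace ℝ (Fin 3)) => Δ (ψ z.1) z.2 := hψ.continuous_laplacian_slice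
  have hLs : HasCompactSupport fun z : ℝ × (EuclideanSpace ℝ (Fin 3)) => Δ (ψ z.1) z.2 :=
    HasCompactSupport.intro hK fun z hz => laplacian_slice_eq_zero_of_notMem hz
  obtain ⟨C₃, -, hC₃⟩ := exists_norm_le_of_hasCompactSupport hLc hLs
  -- the three terms
  have h1 : IntegrableOn (fun z : ℝ × (EuclideanSpace ℝ (Fin 3)) => ⟪V z.1 z.2, timeDeriv ψ z.1 z.2⟫) (Q : Set (ℝ × (EuclideanSpace ℝ (Fin 3))))
      volume := by
    refine integrableOn_of_norm_le_of_eq_zero hV1 (hVm.inner hTc.aestronglyMeasurable) hK hKQ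
      (M := C₁) (fun z => ?_) (fun z hz => ?_)
    · rw [norm_norm, mul_comm]
      exact (norm_inner_le_norm _ _).trans (mul_le_mul_of_nonneg_left (hC₁ z) (norm_nonneg _))
    · rw [timeDeriv_eq_zero_off_tsupport hz, inner_zero_right]
  have h2 : IntegrableOn (fun z : ℝ × (EuclideanSpace ℝ (Fin 3)) => ⟪V z.1 z.2, convect (V z.1) (ψ z.1) z.2⟫)
      (Q : Set (ℝ × (EuclideanSpace ℝ (Fin 3)))) volume := by
    have hm : AEStronglyMeasurable (fun z : ℝ × (EuclideanSpace ℝ (Fin 3)) => fderiv ℝ (ψ z.1) z.2 (V z.1 z.2))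
        (volume.restrict (Q : Set (ℝ × (EuclideanSpace ℝ (Fin 3))))) :=
      isBoundedBilinearMap_apply.continuous.comp_aestronglyMeasurable
        (hDc.aestronglyMeasurable.prodMk hVm)
    refine integrableOn_of_norm_le_of_eq_zero hV2 (hVm.inner hm) hK hKQ (M := C₂) (fun z => ?_)
      (fun z hz => ?_)
    · rw [convect_apply, Real.norm_of_nonneg (sq_nonneg _)]
      calc ‖⟪V z.1 z.2, fderiv ℝ (ψ z.1) z.2 (V z.1 z.2)⟫‖
          ≤ ‖V z.1 z.2‖ * ‖fderiv ℝ (ψ z.1) z.2 (V z.1 z.2)‖ := norm_inner_le_norm _ _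
        _ ≤ ‖V z.1 z.2‖ * (C₂ * ‖V z.1 z.2‖) := by
            refine mul_le_mul_of_nonneg_left ?_ (norm_nonneg _)
            exact (ContinuousLinearMap.le_opNorm _ _).trans
              (mul_le_mul_of_nonneg_right (hC₂' z) (norm_nonneg _))
        _ = C₂ * ‖V z.1 z.2‖ ^ 2 := by ring
    · rw [convect_apply, fderiv_slice_eq_zero_of_notMem hz]
      simp
  have h3 : IntegrableOn (fun z : ℝ × (EuclideanSpace ℝ (Fin 3)) => ν * ⟪V z.1 z.2, Δ (ψ z.1) z.2⟫) (Q : Set (ℝ × (EuclideanSpace ℝ (Fin 3))))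
      volume := by
    refine Integrable.const_mul ?_ ν
    refine integrableOn_of_norm_le_of_eq_zero hV1 (hVm.inner hLc.aestronglyMeasurable) hK hKQ
      (M := C₃) (fun z => ?_) (fun z hz => ?_)
    · rw [norm_norm, mul_comm]
      exact (norm_inner_le_norm _ _).trans (mul_le_mul_of_nonneg_left (hC₃ z) (norm_nonneg _))
    · rw [laplacian_slice_eq_zero_of_notMem hz, inner_zero_right]
  exact (h1.add h2).add h3

/-- **The pressure term is integrable on `Q`** for a distributional solution and a test field on
`Q` (`P ∈ L¹_loc(Q)`, `div ψ` bounded and supported in a compact subset of `Q`). [folklore] -/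
theorem integrableOn_pressure_mul_divergence (hNS : IsDistributionalNSSolutionOn Q ν f V P)
    {ψ : ℝ → (EuclideanSpace ℝ (Fin 3)) → (EuclideanSpace ℝ (Fin 3))} (hψ : IsSpaceTimeTestOn Q ψ) :
    IntegrableOn (fun z : ℝ × (EuclideanSpace ℝ (Fin 3)) => P z.1 z.2 * VectorCalculus.divergence (ψ z.1) z.2)
      (Q : Set (ℝ × (EuclideanSpace ℝ (Fin 3)))) volume := by
  have hK : IsCompact (tsupport (uncurry ψ)) := hψ.hasCompactSupport
  have hKQ : tsupport (uncurry ψ) ⊆ (Q : Set (ℝ × (EuclideanSpace ℝ (Fin 3)))) := hψ.tsupport_subset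
  have hPm : AEStronglyMeasurable (fun z : ℝ × (EuclideanSpace ℝ (Fin 3)) => P z.1 z.2)
      (volume.restrict (Q : Set (ℝ × (EuclideanSpace ℝ (Fin 3))))) := hNS.2.2.1.aestronglyMeasurable
  have hdc : Continuous fun z : ℝ × (EuclideanSpace ℝ (Fin 3)) => VectorCalculus.divergence (ψ z.1) z.2 :=
    hψ.continuous_divergence_slice
  have hd0 : ∀ z : ℝ × (EuclideanSpace ℝ (Fin 3)), z ∉ tsupport (uncurry ψ) → VectorCalculus.divergence (ψ z.1) z.2 = 0 :=
    fun z hz => divergence_eq_zero_of_notMem_tsupport (notMem_tsupport_slice_of_notMem hz)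
  have hds : HasCompactSupport fun z : ℝ × (EuclideanSpace ℝ (Fin 3)) => VectorCalculus.divergence (ψ z.1) z.2 :=
    HasCompactSupport.intro hK hd0
  obtain ⟨C, -, hC⟩ := exists_norm_le_of_hasCompactSupport hdc hds
  refine integrableOn_of_norm_le_of_eq_zero hNS.2.2.1 (hPm.mul hdc.aestronglyMeasurable) hK hKQ
    (M := C) (fun z => ?_) (fun z hz => ?_)
  · rw [norm_mul, mul_comm]
    exact mul_le_mul_of_nonneg_right (hC z) (norm_nonneg _)
  · rw [hd0 z hz, mul_zero]

end Integrability

/-! ### The rotation argument -/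

section Rotation

variable {Q : Opens (ℝ × (EuclideanSpace ℝ (Fin 3)))} {ν : ℝ} {V : ℝ → (EuclideanSpace ℝ (Fin 3)) → (EuclideanSpace ℝ (Fin 3))} {P : ℝ → (EuclideanSpace ℝ (Fin 3)) → ℝ}

/-- **The pressure pairing is rotation invariant.** For a distributional Navier–Stokes solution
`(V, P)` (no force) on a rotation-invariant open set `Q` with `V` equivariant at the points of `Q`,
and a test field `ψ` on `Q`, `∫∫_Q P(t, x) (div ψ)(t, R_θ x) = ∫∫_Q P div ψ` for every `θ`: the
momentum equation tested with `ψ` and with `ψ_θ = R_θ⁻¹ψ(·, R_θ ·)`, the covariance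
`nsVPart_rotConj`, `div ψ_θ = (div ψ)(·, R_θ ·)` and the change of variables `(t, x) ↦ (t, R_θ x)`
(Majda–Bertozzi, Prop. 1.1 (iii), for distributional solutions). [folklore] -/
theorem setIntegral_pressure_mul_divergence_stRot
    (hQ : ∀ θ : ℝ, ∀ z ∈ (Q : Set (ℝ × (EuclideanSpace ℝ (Fin 3)))), stRot θ z ∈ (Q : Set (ℝ × (EuclideanSpace ℝ (Fin 3)))))
    (hNS : IsDistributionalNSSolutionOn Q ν 0 V P) (hV : IsAxisymmetricOn (Q : Set (ℝ × (EuclideanSpace ℝ (Fin 3)))) V)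
    {ψ : ℝ → (EuclideanSpace ℝ (Fin 3)) → (EuclideanSpace ℝ (Fin 3))} (hψ : IsSpaceTimeTestOn Q ψ) (θ : ℝ) :
    ∫ z in (Q : Set (ℝ × (EuclideanSpace ℝ (Fin 3)))), P z.1 z.2 * VectorCalculus.divergence (ψ z.1) (rotZ θ z.2) =
      ∫ z in (Q : Set (ℝ × (EuclideanSpace ℝ (Fin 3)))), P z.1 z.2 * VectorCalculus.divergence (ψ z.1) z.2 := by
  set N : ℝ × (EuclideanSpace ℝ (Fin 3)) → ℝ := nsVPart ν V ψ with hN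
  set D : ℝ × (EuclideanSpace ℝ (Fin 3)) → ℝ := fun z => VectorCalculus.divergence (ψ z.1) z.2 with hD
  set Pu : ℝ × (EuclideanSpace ℝ (Fin 3)) → ℝ := fun z => P z.1 z.2 with hPu
  have hmp := measurePreserving_stRot θ
  have hemb := measurableEmbedding_stRot θ
  have hpre : stRot θ ⁻¹' (Q : Set (ℝ × (EuclideanSpace ℝ (Fin 3)))) = Q := preimage_stRot_eq hQ θ
  have hQm : MeasurableSet (Q : Set (ℝ × (EuclideanSpace ℝ (Fin 3)))) := Q.isOpen.measurableSet
  -- the weak form tested with `ψ`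
  have h1 : ∫ z in (Q : Set (ℝ × (EuclideanSpace ℝ (Fin 3)))), (N z + Pu z * D z) = 0 := by
    rw [← hNS.2.2.2.2 ψ hψ]
    refine setIntegral_congr_fun hQm fun z _ => ?_
    simp only [hN, nsVPart, hD, hPu, Pi.zero_apply, inner_zero_left, add_zero]
  -- the weak form tested with `ψ_θ`, rewritten pointwise on `Q`
  have h2 : ∫ z in (Q : Set (ℝ × (EuclideanSpace ℝ (Fin 3)))), (N (stRot θ z) + Pu z * D (stRot θ z)) = 0 := by
    rw [← hNS.2.2.2.2 (rotConj θ ψ) (isSpaceTimeTestOn_rotConj hQ hψ θ)]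
    refine setIntegral_congr_fun hQm fun z hz => ?_
    have hv := nsVPart_rotConj (ν := ν) hV hψ θ hz
    simp only [nsVPart] at hv
    simp only [hN, nsVPart, hD, hPu, Pi.zero_apply, inner_zero_left, add_zero, stRot_fst,
      stRot_snd, ← divergence_rotConj ψ θ z.1 z.2]
    simp only [stRot_fst, stRot_snd] at hv
    rw [hv]
  -- the weak form tested with `ψ`, after the change of variables
  have h3 : ∫ z in (Q : Set (ℝ × (EuclideanSpace ℝ (Fin 3)))), (N (stRot θ z) + Pu (stRot θ z) * D (stRot θ z)) = 0 := by
    have h := hmp.setIntegral_preimage_emb hemb (fun z => N z + Pu z * D z) (Q : Set (ℝ × (EuclideanSpace ℝ (Fin 3))))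
    rw [hpre] at h
    rw [h, h1]
  -- integrability of the pieces
  have hNi : IntegrableOn N (Q : Set (ℝ × (EuclideanSpace ℝ (Fin 3)))) volume := integrableOn_nsVPart hNS hψ
  have hNθ : IntegrableOn (fun z => N (stRot θ z)) (Q : Set (ℝ × (EuclideanSpace ℝ (Fin 3)))) volume := by
    have h := (hmp.integrableOn_comp_preimage hemb (f := N) (s := (Q : Set (ℝ × (EuclideanSpace ℝ (Fin 3)))))).2 hNi
    rwa [hpre] at h
  have hPD : IntegrableOn (fun z => Pu z * D z) (Q : Set (ℝ × (EuclideanSpace ℝ (Fin 3)))) volume :=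
    integrableOn_pressure_mul_divergence hNS hψ
  have hPDθ : IntegrableOn (fun z => Pu (stRot θ z) * D (stRot θ z)) (Q : Set (ℝ × (EuclideanSpace ℝ (Fin 3)))) volume := by
    have h := (hmp.integrableOn_comp_preimage hemb (f := fun z => Pu z * D z)
      (s := (Q : Set (ℝ × (EuclideanSpace ℝ (Fin 3)))))).2 hPD
    rwa [hpre] at h
  have hPθD : IntegrableOn (fun z => Pu z * D (stRot θ z)) (Q : Set (ℝ × (EuclideanSpace ℝ (Fin 3)))) volume := by
    have h := integrableOn_pressure_mul_divergence hNS (isSpaceTimeTestOn_rotConj hQ hψ θ)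
    refine h.congr_fun (fun z _ => ?_) hQm
    simp only [hPu, hD, divergence_rotConj, stRot_fst, stRot_snd]
  -- conclusion
  rw [integral_add hNθ hPθD] at h2
  rw [integral_add hNθ hPDθ] at h3
  have h4 : ∫ z in (Q : Set (ℝ × (EuclideanSpace ℝ (Fin 3)))), Pu z * D (stRot θ z) =
      ∫ z in (Q : Set (ℝ × (EuclideanSpace ℝ (Fin 3)))), Pu (stRot θ z) * D (stRot θ z) := by linarith
  have h5 : ∫ z in (Q : Set (ℝ × (EuclideanSpace ℝ (Fin 3)))), Pu (stRot θ z) * D (stRot θ z) =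
      ∫ z in (Q : Set (ℝ × (EuclideanSpace ℝ (Fin 3)))), Pu z * D z := by
    have h := hmp.setIntegral_preimage_emb hemb (fun z => Pu z * D z) (Q : Set (ℝ × (EuclideanSpace ℝ (Fin 3))))
    rw [hpre] at h
    exact h
  show ∫ z in (Q : Set (ℝ × (EuclideanSpace ℝ (Fin 3)))), Pu z * D (stRot θ z) = ∫ z in (Q : Set (ℝ × (EuclideanSpace ℝ (Fin 3)))), Pu z * D z
  rw [h4, h5]

/-- **The pressure drops out of the swirl equation** (Seregin–Zajaczkowski 2007, the absence of a
pressure term in (4.15): `(∇P)_φ = 0` for the axially symmetric pressure; proved here from the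
equations alone). For a distributional Navier–Stokes solution `(V, P)` (no force) on a
rotation-invariant open set `Q ⊆ ℝ × ℝ³` with `V` equivariant under the rotations about the axis
at the points of `Q`, and every scalar test function `φ ∈ C_c^∞(Q)`,
`∫∫_Q P ⟪J x, ∇ₓφ⟫ dx dt = 0`, `J x = (-x₁, x₀, 0)`. Proof: by
`setIntegral_pressure_mul_divergence_stRot` with `ψ = φ J` (`div ψ = ⟪J, ∇φ⟫`) the function
`θ ↦ ∫∫_Q P(t,x) ⟪J(R_θ x), ∇φ(t, R_θ x)⟫` is constant; its integral over `[0, 2π]` is, by Fubini,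
`∫∫_Q P(t,x) ∫₀^{2π} (d/dθ) φ(t, R_θ x) dθ = 0`.
[cite: SereginZajaczkowski2007, §4 proof of Lemma 4.3, (4.15) (no pressure term), with §1 (symmetry convention)] -/
theorem setIntegral_pressure_mul_inner_rotGen_gradient_eq_zero
    (hQ : ∀ θ : ℝ, ∀ z ∈ (Q : Set (ℝ × (EuclideanSpace ℝ (Fin 3)))), stRot θ z ∈ (Q : Set (ℝ × (EuclideanSpace ℝ (Fin 3)))))
    (hNS : IsDistributionalNSSolutionOn Q ν 0 V P) (hV : IsAxisymmetricOn (Q : Set (ℝ × (EuclideanSpace ℝ (Fin 3)))) V)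
    {φ : ℝ → (EuclideanSpace ℝ (Fin 3)) → ℝ} (hφ : IsSpaceTimeTestOn Q φ) :
    ∫ z in (Q : Set (ℝ × (EuclideanSpace ℝ (Fin 3)))), P z.1 z.2 * ⟪rotGen z.2, gradient (φ z.1) z.2⟫ = 0 := by
  have hQm : MeasurableSet (Q : Set (ℝ × (EuclideanSpace ℝ (Fin 3)))) := Q.isOpen.measurableSet
  set ψ : ℝ → (EuclideanSpace ℝ (Fin 3)) → (EuclideanSpace ℝ (Fin 3)) := fun t x => φ t x • rotGen x with hψdef
  have hψ : IsSpaceTimeTestOn Q ψ := isSpaceTimeTestOn_smul_rotGen hφ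
  have hφd : ∀ t x, DifferentiableAt ℝ (φ t) x := fun t x =>
    ((hφ.contDiff_slice t).differentiable (by simp)).differentiableAt
  have hdiv : ∀ t y, VectorCalculus.divergence (ψ t) y = ⟪rotGen y, gradient (φ t) y⟫ :=
    fun t y => divergence_smul_rotGen (hφd t y)
  set κ : ℝ × (EuclideanSpace ℝ (Fin 3)) → ℝ := fun z => ⟪rotGen z.2, gradient (φ z.1) z.2⟫ with hκ
  set Pu : ℝ × (EuclideanSpace ℝ (Fin 3)) → ℝ := fun z => P z.1 z.2 with hPu
  -- (1) rotation invariance of the pairing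
  have hinv : ∀ θ, ∫ z in (Q : Set (ℝ × (EuclideanSpace ℝ (Fin 3)))), Pu z * κ (stRot θ z) =
      ∫ z in (Q : Set (ℝ × (EuclideanSpace ℝ (Fin 3)))), Pu z * κ z := by
    intro θ
    have h := setIntegral_pressure_mul_divergence_stRot hQ hNS hV hψ θ
    simp only [hdiv] at h
    exact h
  -- (2) the angular derivative integrates to zero over a full turn
  have hκc : Continuous κ :=
    (rotGenL.continuous.comp continuous_snd).inner hφ.continuous_slice_gradient
  have hftc : ∀ z : ℝ × (EuclideanSpace ℝ (Fin 3)), ∫ θ in (0 : ℝ)..2 * Real.pi, κ (stRot θ z) = 0 := by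
    intro z
    have hder : ∀ θ, HasDerivAt (fun θ => φ z.1 (rotZ θ z.2)) (κ (stRot θ z)) θ := by
      intro θ
      refine (((hφd z.1 (rotZ θ z.2)).hasFDerivAt).comp_hasDerivAt θ
        (hasDerivAt_rotZ z.2 θ)).congr_deriv ?_
      simp only [hκ, stRot_fst, stRot_snd]
      rw [real_inner_comm, inner_gradient_left, rotGen_rotZ_eq]
    have hc : Continuous fun θ => κ (stRot θ z) :=
      hκc.comp (continuous_stRot_prod.comp (continuous_id.prodMk continuous_const))
    rw [intervalIntegral.integral_eq_sub_of_hasDerivAt (fun θ _ => hder θ) (hc.intervalIntegrable _ _),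
      rotZ_two_pi, rotZ_zero, sub_self]
  -- (3) joint integrability on `[0, 2π] × Q`
  have hT : IsCompact (tsupport (uncurry φ)) := hφ.hasCompactSupport
  have hTQ : tsupport (uncurry φ) ⊆ (Q : Set (ℝ × (EuclideanSpace ℝ (Fin 3)))) := hφ.tsupport_subset
  have hκ0 : ∀ z, z ∉ tsupport (uncurry φ) → κ z = 0 := fun z hz => by
    simp only [hκ, gradient, fderiv_slice_eq_zero_of_notMem hz, map_zero,
      inner_zero_right]
  obtain ⟨M, hM0, hM⟩ := exists_norm_le_of_hasCompactSupport hκc (HasCompactSupport.intro hT hκ0)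
  set K' : Set (ℝ × (EuclideanSpace ℝ (Fin 3))) := (fun p : ℝ × (ℝ × (EuclideanSpace ℝ (Fin 3))) => stRot (-p.1) p.2) ''
    (Icc (0 : ℝ) (2 * Real.pi) ×ˢ tsupport (uncurry φ)) with hK'
  have hK'c : IsCompact K' :=
    (isCompact_Icc.prod hT).image
      (continuous_stRot_prod.comp (continuous_fst.neg.prodMk continuous_snd))
  have hK'Q : K' ⊆ (Q : Set (ℝ × (EuclideanSpace ℝ (Fin 3)))) := by
    rintro _ ⟨p, hp, rfl⟩
    exact hQ (-p.1) p.2 (hTQ hp.2)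
  have hK'm : MeasurableSet K' := hK'c.measurableSet
  have hmemK' : ∀ θ ∈ Icc (0 : ℝ) (2 * Real.pi), ∀ z : ℝ × (EuclideanSpace ℝ (Fin 3)), κ (stRot θ z) ≠ 0 → z ∈ K' := by
    intro θ hθ z hz
    have hz' : stRot θ z ∈ tsupport (uncurry φ) := by
      by_contra h
      exact hz (hκ0 _ h)
    exact ⟨(θ, stRot θ z), ⟨hθ, hz'⟩, stRot_neg_stRot θ z⟩
  have hPK' : IntegrableOn Pu K' volume := hNS.2.2.1.integrableOn_compact_subset hK'Q hK'c
  have hprod : Integrable (uncurry fun θ z => Pu z * κ (stRot θ z))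
      ((volume.restrict (Ioc (0 : ℝ) (2 * Real.pi))).prod
        (volume.restrict (Q : Set (ℝ × (EuclideanSpace ℝ (Fin 3)))))) := by
    have hg : Integrable (fun p : ℝ × (ℝ × (EuclideanSpace ℝ (Fin 3))) => M * ‖K'.indicator Pu p.2‖)
        ((volume.restrict (Ioc (0 : ℝ) (2 * Real.pi))).prod
          (volume.restrict (Q : Set (ℝ × (EuclideanSpace ℝ (Fin 3)))))) := by
      have h1 : Integrable (fun _ : ℝ => M) (volume.restrict (Ioc (0 : ℝ) (2 * Real.pi))) :=
        integrable_const M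
      have h2 : Integrable (fun z : ℝ × (EuclideanSpace ℝ (Fin 3)) => ‖K'.indicator Pu z‖)
          (volume.restrict (Q : Set (ℝ × (EuclideanSpace ℝ (Fin 3))))) :=
        ((hPK'.integrable_indicator hK'm).norm).integrableOn
      exact h1.mul_prod h2
    have hm : AEStronglyMeasurable (uncurry fun θ z => Pu z * κ (stRot θ z))
        ((volume.restrict (Ioc (0 : ℝ) (2 * Real.pi))).prod
          (volume.restrict (Q : Set (ℝ × (EuclideanSpace ℝ (Fin 3)))))) := by
      have hP' : AEStronglyMeasurable Pu (volume.restrict (Q : Set (ℝ × (EuclideanSpace ℝ (Fin 3))))) :=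
        hNS.2.2.1.aestronglyMeasurable
      exact hP'.comp_snd.mul (hκc.comp continuous_stRot_prod).aestronglyMeasurable
    refine Integrable.mono' hg hm ?_
    rw [Measure.prod_restrict] at hg ⊢
    rw [ae_restrict_iff' (measurableSet_Ioc.prod hQm)]
    refine Eventually.of_forall ?_
    rintro ⟨θ, z⟩ ⟨hθ, -⟩
    simp only [uncurry]
    by_cases hz : κ (stRot θ z) = 0
    · rw [hz, mul_zero, norm_zero]
      exact mul_nonneg hM0 (norm_nonneg _)
    · rw [indicator_of_mem (hmemK' θ (Ioc_subset_Icc_self hθ) z hz), norm_mul, mul_comm]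
      exact mul_le_mul_of_nonneg_right (hM _) (norm_nonneg _)
  -- (4) averaging over a full turn
  have h2π : (0 : ℝ) ≤ 2 * Real.pi := by positivity
  have hswap : (∫ θ in (0 : ℝ)..2 * Real.pi, ∫ z in (Q : Set (ℝ × (EuclideanSpace ℝ (Fin 3)))), Pu z * κ (stRot θ z)) =
      ∫ z in (Q : Set (ℝ × (EuclideanSpace ℝ (Fin 3)))), Pu z * ∫ θ in (0 : ℝ)..2 * Real.pi, κ (stRot θ z) := by
    rw [intervalIntegral.integral_of_le h2π]
    simp_rw [intervalIntegral.integral_of_le h2π]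
    rw [integral_integral_swap hprod]
    refine integral_congr_ae (Eventually.of_forall fun z => ?_)
    exact integral_const_mul _ _
  have hconst : (∫ θ in (0 : ℝ)..2 * Real.pi, ∫ z in (Q : Set (ℝ × (EuclideanSpace ℝ (Fin 3)))), Pu z * κ (stRot θ z)) =
      (2 * Real.pi) * ∫ z in (Q : Set (ℝ × (EuclideanSpace ℝ (Fin 3)))), Pu z * κ z := by
    simp_rw [hinv]
    rw [intervalIntegral.integral_const, smul_eq_mul, sub_zero]
  have hzero : (∫ θ in (0 : ℝ)..2 * Real.pi, ∫ z in (Q : Set (ℝ × (EuclideanSpace ℝ (Fin 3)))), Pu z * κ (stRot θ z)) = 0 := by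
    rw [hswap]
    simp_rw [hftc]
    simp
  have hπ : (2 * Real.pi : ℝ) ≠ 0 := by positivity
  exact (mul_eq_zero.1 (hconst.symm.trans hzero)).resolve_left hπ

end Rotation

end SereginZajaczkowski2007

end Literature.Analysis.FluidPDE
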